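import Mathlib.Probability.Distributions.Gamma
import Mathlib.Probability.CDF
import HarnessLib

/-!
# The Gamma family is stochastically increasing in the shape parameter

For a fixed rate `r > 0` and shapes `0 < a ≤ a'`, `Gamma(a', r)` dominates `Gamma(a, r)` in the
likelihood-ratio order (the density ratio `g_{a'}/g_a = K · t^{a'−a}` is increasing on `(0, ∞)`), hence
in the usual stochastic order: `P(Gamma(a', r) ≤ x) ≤ P(Gamma(a, r) ≤ x)` for every `x`.
Source: F. Belzunce, C. Martínez-Riquelme, J. Mulero, *An Introduction to Stochastic Orders*
(Elsevier/Academic Press 2016) [BelzunceMartinezRiquelmeMulero2016], Example 2.5.5 (Gamma: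
`α₁ ≤ α₂`, equal scale ⇒ `X ≤_lr Y`) with eq. (2.23) (`≤_lr ⇒ ≤_st`, Definition 2.5.1 / Theorem 2.2.6)
[materialised text chunk p0053:L12, p0052:L5–L17].

Proof typed here (the standard likelihood-ratio argument, division-free, in `ℝ≥0∞`): with
`k := K x^{a'−a}`, on `(−∞, x]` the density of `Gamma(a', r)` is `≤ k ·` that of `Gamma(a, r)` and on
`(x, ∞)` it is `≥ k ·` it; so `F_{a'}(x) ≤ k F_a(x)` and `1 − F_{a'}(x) ≥ k (1 − F_a(x))`, and either
`k ≤ 1` or `k ≥ 1` gives `F_{a'}(x) ≤ F_a(x)`.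

Stated over Mathlib's `ProbabilityTheory.gammaMeasure a r = volume.withDensity (gammaPDF a r)` and
`ProbabilityTheory.cdf`.  Serves cell qa-cr line L-01 (`xeb-selection-ceiling`, rider stub
`stub_xebCDF_shape_antitone`: `l ↦ cdf (gammaMeasure (m + l) 1) (m(χ+1))` is antitone), which is the
special case `r = 1`, integer shapes — see `antitone_nat_cdf_gammaMeasure_shape_add`.
No facts, no sorries.
-/

namespace Literature.Probability.Distributions

open MeasureTheory ProbabilityTheory Set Real

/-- The Gamma density ratio: for `0 < t`,
`gammaPDFReal a' r t = ((r^{a'}/Γ(a')) / (r^{a}/Γ(a))) · t^{a'−a} · gammaPDFReal a r t`.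
[cite: BelzunceMartinezRiquelmeMulero2016, Example 2.5.5] -/
theorem gammaPDFReal_eq_ratio_mul {a a' r : ℝ} (ha : 0 < a) (hr : 0 < r) {t : ℝ} (ht : 0 < t) :
    gammaPDFReal a' r t =
      (r ^ a' / Gamma a') / (r ^ a / Gamma a) * t ^ (a' - a) * gammaPDFReal a r t := by
  have hra : 0 < r ^ a := rpow_pos_of_pos hr a
  have hΓ : 0 < Gamma a := Gamma_pos_of_pos ha
  simp only [gammaPDFReal, if_pos ht.le]
  rw [show a' - 1 = (a' - a) + (a - 1) by ring, Real.rpow_add ht]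
  field_simp

/-- Lebesgue-almost every real is nonzero (plumbing). [folklore] -/
private theorem gammaShape_ae_ne_zero : ∀ᵐ t ∂(volume : Measure ℝ), t ≠ 0 := by
  rw [ae_iff]
  simp

/-- Likelihood-ratio comparison below `x`: for `0 < a ≤ a'`, `0 < r`, `0 < x`,
`Gamma(a',r)((−∞,x]) ≤ K x^{a'−a} · Gamma(a,r)((−∞,x])`.
[cite: BelzunceMartinezRiquelmeMulero2016, Example 2.5.5 + Def 2.5.1] -/
theorem gammaMeasure_Iic_le_ratio_mul {a a' r : ℝ} (ha : 0 < a) (hle : a ≤ a') (hr : 0 < r)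
    {x : ℝ} (hx : 0 < x) :
    gammaMeasure a' r (Iic x) ≤
      ENNReal.ofReal ((r ^ a' / Gamma a') / (r ^ a / Gamma a) * x ^ (a' - a)) *
        gammaMeasure a r (Iic x) := by
  set K : ℝ := (r ^ a' / Gamma a') / (r ^ a / Gamma a) with hK
  have hK0 : 0 ≤ K := by
    have ha' : 0 < a' := lt_of_lt_of_le ha hle
    positivity
  have hmono : ∀ᵐ t ∂(volume.restrict (Iic x)),
      gammaPDF a' r t ≤ ENNReal.ofReal (K * x ^ (a' - a)) * gammaPDF a r t := by
    rw [ae_restrict_iff' measurableSet_Iic]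
    filter_upwards [gammaShape_ae_ne_zero] with t ht0 htx
    rcases lt_or_gt_of_ne ht0 with hneg | hpos
    · rw [gammaPDF_of_neg hneg]
      exact zero_le
    · rw [gammaPDF, gammaPDF, gammaPDFReal_eq_ratio_mul (a' := a') ha hr hpos, ← hK,
        ← ENNReal.ofReal_mul (by positivity)]
      apply ENNReal.ofReal_le_ofReal
      have h1 : t ^ (a' - a) ≤ x ^ (a' - a) := Real.rpow_le_rpow hpos.le htx (by linarith)
      have hp : 0 ≤ gammaPDFReal a r t := gammaPDFReal_nonneg ha hr t
      have := mul_le_mul_of_nonneg_left h1 hK0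
      exact mul_le_mul_of_nonneg_right this hp
  calc gammaMeasure a' r (Iic x) = ∫⁻ t in Iic x, gammaPDF a' r t := by
        rw [gammaMeasure, withDensity_apply _ measurableSet_Iic]
    _ ≤ ∫⁻ t in Iic x, ENNReal.ofReal (K * x ^ (a' - a)) * gammaPDF a r t := lintegral_mono_ae hmono
    _ = ENNReal.ofReal (K * x ^ (a' - a)) * ∫⁻ t in Iic x, gammaPDF a r t :=
        lintegral_const_mul' _ _ ENNReal.ofReal_ne_top
    _ = ENNReal.ofReal (K * x ^ (a' - a)) * gammaMeasure a r (Iic x) := by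
        rw [gammaMeasure, withDensity_apply _ measurableSet_Iic]

/-- Likelihood-ratio comparison above `x`: for `0 < a ≤ a'`, `0 < r`, `0 < x`,
`K x^{a'−a} · Gamma(a,r)((x,∞)) ≤ Gamma(a',r)((x,∞))`.
[cite: BelzunceMartinezRiquelmeMulero2016, Example 2.5.5 + Def 2.5.1] -/
theorem ratio_mul_gammaMeasure_Ioi_le {a a' r : ℝ} (ha : 0 < a) (hle : a ≤ a') (hr : 0 < r)
    {x : ℝ} (hx : 0 < x) :
    ENNReal.ofReal ((r ^ a' / Gamma a') / (r ^ a / Gamma a) * x ^ (a' - a)) *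
        gammaMeasure a r (Ioi x) ≤ gammaMeasure a' r (Ioi x) := by
  set K : ℝ := (r ^ a' / Gamma a') / (r ^ a / Gamma a) with hK
  have hK0 : 0 ≤ K := by
    have ha' : 0 < a' := lt_of_lt_of_le ha hle
    positivity
  have hmono : ∀ᵐ t ∂(volume.restrict (Ioi x)),
      ENNReal.ofReal (K * x ^ (a' - a)) * gammaPDF a r t ≤ gammaPDF a' r t := by
    rw [ae_restrict_iff' measurableSet_Ioi]
    refine ae_of_all _ fun t (hxt : x < t) => ?_
    have hpos : 0 < t := hx.trans hxt
    rw [gammaPDF, gammaPDF, gammaPDFReal_eq_ratio_mul (a' := a') ha hr hpos, ← hK,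
      ← ENNReal.ofReal_mul (by positivity)]
    apply ENNReal.ofReal_le_ofReal
    have h1 : x ^ (a' - a) ≤ t ^ (a' - a) := Real.rpow_le_rpow hx.le hxt.le (by linarith)
    have hp : 0 ≤ gammaPDFReal a r t := gammaPDFReal_nonneg ha hr t
    have := mul_le_mul_of_nonneg_left h1 hK0
    exact mul_le_mul_of_nonneg_right this hp
  calc ENNReal.ofReal (K * x ^ (a' - a)) * gammaMeasure a r (Ioi x)
        = ENNReal.ofReal (K * x ^ (a' - a)) * ∫⁻ t in Ioi x, gammaPDF a r t := by
          rw [gammaMeasure, withDensity_apply _ measurableSet_Ioi]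
    _ = ∫⁻ t in Ioi x, ENNReal.ofReal (K * x ^ (a' - a)) * gammaPDF a r t :=
        (lintegral_const_mul' _ _ ENNReal.ofReal_ne_top).symm
    _ ≤ ∫⁻ t in Ioi x, gammaPDF a' r t := lintegral_mono_ae hmono
    _ = gammaMeasure a' r (Ioi x) := by rw [gammaMeasure, withDensity_apply _ measurableSet_Ioi]

/-- The Gamma law puts no mass on `(−∞, x]` for `x ≤ 0`. [cite: BelzunceMartinezRiquelmeMulero2016, Example 2.5.5] -/
theorem gammaMeasure_Iic_eq_zero_of_nonpos (a r : ℝ) {x : ℝ} (hx : x ≤ 0) :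
    gammaMeasure a r (Iic x) = 0 := by
  have h1 : gammaMeasure a r (Iio 0) = 0 := by
    rw [gammaMeasure, withDensity_apply _ measurableSet_Iio,
      setLIntegral_congr_fun measurableSet_Iio (fun t (ht : t < 0) => gammaPDF_of_neg ht),
      lintegral_zero]
  have h2 : gammaMeasure a r {0} = 0 :=
    withDensity_absolutelyContinuous _ _ (measure_singleton (0 : ℝ))
  have hsub : Iic x ⊆ Iio 0 ∪ {0} := by
    intro t ht
    rcases lt_or_eq_of_le (le_trans ht hx) with h | h
    · exact Or.inl h
    · exact Or.inr h
  refine le_antisymm ?_ zero_le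
  calc gammaMeasure a r (Iic x) ≤ gammaMeasure a r (Iio 0 ∪ {0}) := measure_mono hsub
    _ ≤ gammaMeasure a r (Iio 0) + gammaMeasure a r {0} := measure_union_le _ _
    _ = 0 := by rw [h1, h2, add_zero]

/-- **Gamma is stochastically increasing in the shape** (measure form): for `0 < a ≤ a'`, `0 < r` and
every `x`, `Gamma(a', r)((−∞, x]) ≤ Gamma(a, r)((−∞, x])`.
[cite: BelzunceMartinezRiquelmeMulero2016, Example 2.5.5 + (2.23)] -/
theorem gammaMeasure_Iic_anti_shape {a a' r : ℝ} (ha : 0 < a) (hle : a ≤ a') (hr : 0 < r) (x : ℝ) :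
    gammaMeasure a' r (Iic x) ≤ gammaMeasure a r (Iic x) := by
  rcases le_or_gt x 0 with hx | hx
  · rw [gammaMeasure_Iic_eq_zero_of_nonpos a' r hx]
    exact zero_le
  have ha' : 0 < a' := lt_of_lt_of_le ha hle
  haveI := isProbabilityMeasure_gammaMeasure ha hr
  haveI := isProbabilityMeasure_gammaMeasure ha' hr
  set k := ENNReal.ofReal ((r ^ a' / Gamma a') / (r ^ a / Gamma a) * x ^ (a' - a)) with hk
  have h1 := gammaMeasure_Iic_le_ratio_mul ha hle hr hx
  have h2 := ratio_mul_gammaMeasure_Ioi_le ha hle hr hx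
  rw [← hk] at h1 h2
  rcases le_or_gt k 1 with hk1 | hk1
  · -- `F_{a'} ≤ k F_a ≤ F_a`
    calc gammaMeasure a' r (Iic x) ≤ k * gammaMeasure a r (Iic x) := h1
      _ ≤ 1 * gammaMeasure a r (Iic x) := mul_le_mul_of_nonneg_right hk1 zero_le
      _ = gammaMeasure a r (Iic x) := one_mul _
  · -- `1 − F_{a'} ≥ k (1 − F_a) ≥ 1 − F_a`
    have hc : ∀ b : ℝ, (Iic b)ᶜ = Ioi b := fun b => compl_Iic
    have e1 : gammaMeasure a r (Ioi x) = 1 - gammaMeasure a r (Iic x) := by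
      rw [← hc, prob_compl_eq_one_sub measurableSet_Iic]
    have e2 : gammaMeasure a' r (Ioi x) = 1 - gammaMeasure a' r (Iic x) := by
      rw [← hc, prob_compl_eq_one_sub measurableSet_Iic]
    have h3 : 1 - gammaMeasure a r (Iic x) ≤ 1 - gammaMeasure a' r (Iic x) := by
      rw [← e1, ← e2]
      calc gammaMeasure a r (Ioi x) = 1 * gammaMeasure a r (Ioi x) := (one_mul _).symm
        _ ≤ k * gammaMeasure a r (Ioi x) := mul_le_mul_of_nonneg_right hk1.le zero_le
        _ ≤ gammaMeasure a' r (Ioi x) := h2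
    exact (ENNReal.sub_le_sub_iff_left prob_le_one ENNReal.one_ne_top).mp h3

/-- **Gamma is stochastically increasing in the shape** (distribution-function form, Belzunce et al.
Example 2.5.5 with (2.23)): for `0 < a ≤ a'`, `0 < r` and every `x ∈ ℝ`,
`P(Gamma(a', r) ≤ x) ≤ P(Gamma(a, r) ≤ x)`, i.e. the regularized lower incomplete Gamma function
`P(a, r x)` is non-increasing in `a`. [cite: BelzunceMartinezRiquelmeMulero2016, Example 2.5.5 + (2.23)] -/
theorem cdf_gammaMeasure_anti_shape {a a' r : ℝ} (ha : 0 < a) (hle : a ≤ a') (hr : 0 < r) (x : ℝ) :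
    cdf (gammaMeasure a' r) x ≤ cdf (gammaMeasure a r) x := by
  have ha' : 0 < a' := lt_of_lt_of_le ha hle
  haveI := isProbabilityMeasure_gammaMeasure ha hr
  haveI := isProbabilityMeasure_gammaMeasure ha' hr
  rw [cdf_eq_real, cdf_eq_real, measureReal_def, measureReal_def]
  exact ENNReal.toReal_mono (measure_ne_top _ _) (gammaMeasure_Iic_anti_shape ha hle hr x)

/-- The shape-monotonicity as an `AntitoneOn` statement on `(0, ∞)`.
[cite: BelzunceMartinezRiquelmeMulero2016, Example 2.5.5 + (2.23)] -/
theorem antitoneOn_cdf_gammaMeasure_shape {r : ℝ} (hr : 0 < r) (x : ℝ) :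
    AntitoneOn (fun a : ℝ => cdf (gammaMeasure a r) x) (Ioi 0) :=
  fun _ ha _ _ hle => cdf_gammaMeasure_anti_shape ha hle hr x

/-- Integer-shifted shapes (the form used for sums of `m + l` unit exponentials, e.g. linear-XEB scores
given `l` ideal samples): for `0 < s`, `l ↦ P(Gamma(s + l, r) ≤ x)` is antitone on `ℕ`.
[cite: BelzunceMartinezRiquelmeMulero2016, Example 2.5.5 + (2.23)] -/
theorem antitone_nat_cdf_gammaMeasure_shape_add {s r : ℝ} (hs : 0 < s) (hr : 0 < r) (x : ℝ) :
    Antitone (fun l : ℕ => cdf (gammaMeasure (s + l) r) x) := by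
  intro l l' hll'
  exact cdf_gammaMeasure_anti_shape (by positivity) (by simpa using hll') hr x

end Literature.Probability.Distributions
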